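import Literature.Analysis.Pluripotential.RegularisedMax
import HarnessLib

/-!
# The regularised maximum of two strictly `J₀`-plurisubharmonic functions on `ℝ⁴`

Topic `Literature/Geometry/Symplectic`; proofs file of the fact seat of
`Literature.Geometry.Symplectic.Gompf1998_thm13_twoHandles` (**E2**, `SteinTwoHandles.lean`).
`Literature/Analysis/Pluripotential/RegularisedMax.lean` provides the regularised maximum
`m_η(x, y)` (`smoothMax`) and the second derivative of `m_η(a, b)` for `C²` functions `a, b` on a
normed space (`fderiv_fderiv_smoothMax_apply`); `SteinSmoothMax.lean` the `J`-convexity of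
`m_η(φ, ψ)` on the tree's `4`-manifolds.  This file records the **flat `ℝ⁴ = ℂ²` version** for a
constant linear `J₀` and the flat Levi quadratic form `L_a(w)(u) = D²a_w(u,u) + D²a_w(J₀u,J₀u)`
(Cieliebak–Eliashberg 2012, Cor. 3.16 / §3.2: the smoothed maximum of `J`-convex functions is
`J`-convex):

* `hasFDerivAt_smoothMax_comp` — `d m_η(a,b) = ½(1+σ) da + ½(1-σ) db`, `σ = S'((a-b)/η) ∈ [-1,1]`
  (the gradient is a convex combination of the two gradients);
* `levi_flat_smoothMax_ge` / `levi_flat_smoothMax_pos` — `L_{m_η(a,b)} ≥ ½(1+σ) L_a + ½(1-σ) L_b`,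
  hence positive where both `L_a, L_b` are;
* `smoothMax_comp_eventuallyEq_left/right` — `m_η(a,b) = a` near points where `a > b + η`
  (resp. `= b` where `b > a + η`).

Everything is **proved**; no definition, no named fact.

## References

* K. Cieliebak, Ya. Eliashberg, *From Stein to Weinstein and Back*, AMS Colloquium Publ. 59
  (2012), §3.2, Cor. 3.16. [CieliebakEliashberg2012]
-/

noncomputable section

open Set Filter
open scoped Topology ContDiff

namespace Literature.Geometry.Symplectic

open Literature.Analysis.Pluripotential

variable {E : Type*} [NormedAddCommGroup E] [NormedSpace ℝ E]

/-! ### The gradient of the regularised maximum -/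

/-- **The differential of `m_η(a, b)`** at a point of differentiability of `a` and `b`:
`d m_η(a,b)_w = ½(1 + σ) da_w + ½(1 - σ) db_w` with `σ = smoothSign ((a w - b w)/η)`.
[folklore] -/
theorem hasFDerivAt_smoothMax_comp {a b : E → ℝ} {a' b' : E →L[ℝ] ℝ} {w : E} {η : ℝ} (hη : η ≠ 0)
    (ha : HasFDerivAt a a' w) (hb : HasFDerivAt b b' w) :
    HasFDerivAt (fun z => smoothMax η (a z) (b z))
      (((1 + smoothSign ((a w - b w) / η)) / 2) • a' + ((1 - smoothSign ((a w - b w) / η)) / 2) • b') w := by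
  have hfun : (fun z => smoothMax η (a z) (b z)) =
      fun z => 2⁻¹ * (a z + b z) + (2⁻¹ * η) * smoothAbs (η⁻¹ * (a z - b z)) := by
    funext z
    simp only [smoothMax, div_eq_inv_mul]
    ring
  rw [hfun, div_eq_inv_mul]
  have hd : HasFDerivAt (fun z => η⁻¹ * (a z - b z)) ((η⁻¹ : ℝ) • (a' - b')) w :=
    (ha.sub hb).const_mul η⁻¹
  have hS := ((hasDerivAt_smoothAbs _).comp_hasFDerivAt w hd).const_mul (2⁻¹ * η)
  have hsum := ((ha.add hb).const_mul 2⁻¹).add hS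
  refine hsum.congr_fderiv ?_
  ext v
  simp only [FunLike.coe_add, FunLike.coe_smul, FunLike.coe_sub, Pi.add_apply,
    Pi.smul_apply, Pi.sub_apply, smul_eq_mul]
  field_simp
  ring

/-- `fderiv` form of the gradient formula. [folklore] -/
theorem fderiv_smoothMax_comp_apply {a b : E → ℝ} {w : E} {η : ℝ} (hη : η ≠ 0)
    (ha : DifferentiableAt ℝ a w) (hb : DifferentiableAt ℝ b w) (v : E) :
    fderiv ℝ (fun z => smoothMax η (a z) (b z)) w v =
      (1 + smoothSign ((a w - b w) / η)) / 2 * fderiv ℝ a w v +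
        (1 - smoothSign ((a w - b w) / η)) / 2 * fderiv ℝ b w v := by
  rw [(hasFDerivAt_smoothMax_comp hη ha.hasFDerivAt hb.hasFDerivAt).fderiv]
  simp only [FunLike.coe_add, FunLike.coe_smul, Pi.add_apply, Pi.smul_apply, smul_eq_mul]

/-- The two gradient weights are non-negative and sum to `1`. [folklore] -/
theorem smoothMax_weights (t : ℝ) :
    0 ≤ (1 + smoothSign t) / 2 ∧ 0 ≤ (1 - smoothSign t) / 2 ∧
      (1 + smoothSign t) / 2 + (1 - smoothSign t) / 2 = 1 := by
  refine ⟨by linarith [neg_one_le_smoothSign t], by linarith [smoothSign_le_one t], by ring⟩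

/-! ### The flat Levi form of the regularised maximum -/

/-- **`L_{m_η(a,b)}(w)(u) ≥ ½(1+σ) L_a(w)(u) + ½(1-σ) L_b(w)(u)`** for the flat Levi quadratic
form `L_a(w)(u) = D²a_w(u,u) + D²a_w(J₀u,J₀u)` of any linear `J₀`. [cite: CieliebakEliashberg2012, Cor. 3.16] -/
theorem levi_flat_smoothMax_ge (J₀ : E →L[ℝ] E) {a b : E → ℝ} {w : E} {η : ℝ} (hη : 0 < η)
    (ha : ContDiffAt ℝ 2 a w) (hb : ContDiffAt ℝ 2 b w) (u : E) :
    (1 + smoothSign ((a w - b w) / η)) / 2 *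
        (fderiv ℝ (fderiv ℝ a) w u u + fderiv ℝ (fderiv ℝ a) w (J₀ u) (J₀ u)) +
      (1 - smoothSign ((a w - b w) / η)) / 2 *
        (fderiv ℝ (fderiv ℝ b) w u u + fderiv ℝ (fderiv ℝ b) w (J₀ u) (J₀ u)) ≤
    fderiv ℝ (fderiv ℝ fun z => smoothMax η (a z) (b z)) w u u +
      fderiv ℝ (fderiv ℝ fun z => smoothMax η (a z) (b z)) w (J₀ u) (J₀ u) := by
  rw [fderiv_fderiv_smoothMax_apply hη.ne' ha hb u, fderiv_fderiv_smoothMax_apply hη.ne' ha hb (J₀ u)]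
  have hσ' : 0 ≤ deriv smoothSign ((a w - b w) / η) / (2 * η) :=
    div_nonneg (deriv_smoothSign_nonneg _) (by linarith)
  nlinarith [mul_nonneg hσ' (sq_nonneg (fderiv ℝ a w u - fderiv ℝ b w u)),
    mul_nonneg hσ' (sq_nonneg (fderiv ℝ a w (J₀ u) - fderiv ℝ b w (J₀ u)))]

/-- **The regularised maximum of two strictly `J₀`-plurisubharmonic functions is strictly
`J₀`-plurisubharmonic** (pointwise, on a given vector). [cite: CieliebakEliashberg2012, Cor. 3.16] -/
theorem levi_flat_smoothMax_pos (J₀ : E →L[ℝ] E) {a b : E → ℝ} {w : E} {η : ℝ} (hη : 0 < η)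
    (ha : ContDiffAt ℝ 2 a w) (hb : ContDiffAt ℝ 2 b w) {u : E}
    (hLa : 0 < fderiv ℝ (fderiv ℝ a) w u u + fderiv ℝ (fderiv ℝ a) w (J₀ u) (J₀ u))
    (hLb : 0 < fderiv ℝ (fderiv ℝ b) w u u + fderiv ℝ (fderiv ℝ b) w (J₀ u) (J₀ u)) :
    0 < fderiv ℝ (fderiv ℝ fun z => smoothMax η (a z) (b z)) w u u +
      fderiv ℝ (fderiv ℝ fun z => smoothMax η (a z) (b z)) w (J₀ u) (J₀ u) := by
  have hge := levi_flat_smoothMax_ge J₀ hη ha hb u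
  obtain ⟨h1, h2, h3⟩ := smoothMax_weights ((a w - b w) / η)
  -- one of the weights is at least `1/2`
  have key : 0 < (1 + smoothSign ((a w - b w) / η)) / 2 *
        (fderiv ℝ (fderiv ℝ a) w u u + fderiv ℝ (fderiv ℝ a) w (J₀ u) (J₀ u)) +
      (1 - smoothSign ((a w - b w) / η)) / 2 *
        (fderiv ℝ (fderiv ℝ b) w u u + fderiv ℝ (fderiv ℝ b) w (J₀ u) (J₀ u)) := by
    rcases le_or_gt (1 / 2) ((1 + smoothSign ((a w - b w) / η)) / 2) with hw | hw
    · nlinarith [mul_nonneg h2 hLb.le]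
    · have hw' : 1 / 2 ≤ (1 - smoothSign ((a w - b w) / η)) / 2 := by linarith
      nlinarith [mul_nonneg h1 hLa.le]
  linarith

/-! ### Where one function dominates -/

/-- **`m_η(a, b) = a` near a point where `a > b + η`** (both continuous there). [folklore] -/
theorem smoothMax_comp_eventuallyEq_left {X : Type*} [TopologicalSpace X] {a b : X → ℝ} {w : X}
    {η : ℝ} (hη : 0 < η) (ha : ContinuousAt a w) (hb : ContinuousAt b w) (h : b w + η < a w) :
    (fun z => smoothMax η (a z) (b z)) =ᶠ[𝓝 w] a := by
  have hc : ContinuousAt (fun z => a z - b z) w := ha.sub hb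
  have hev : ∀ᶠ z in 𝓝 w, η < a z - b z := hc.eventually (Ioi_mem_nhds (by linarith))
  filter_upwards [hev] with z hz using smoothMax_eq_left hη (by linarith)

/-- **`m_η(a, b) = b` near a point where `b > a + η`.** [folklore] -/
theorem smoothMax_comp_eventuallyEq_right {X : Type*} [TopologicalSpace X] {a b : X → ℝ} {w : X}
    {η : ℝ} (hη : 0 < η) (ha : ContinuousAt a w) (hb : ContinuousAt b w) (h : a w + η < b w) :
    (fun z => smoothMax η (a z) (b z)) =ᶠ[𝓝 w] b := by
  have hc : ContinuousAt (fun z => b z - a z) w := hb.sub ha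
  have hev : ∀ᶠ z in 𝓝 w, η < b z - a z := hc.eventually (Ioi_mem_nhds (by linarith))
  filter_upwards [hev] with z hz using smoothMax_eq_right hη (by linarith)

/-- `m_η(a, b)` is `C^∞` if `a` and `b` are. [folklore] -/
theorem contDiff_smoothMax_comp {a b : E → ℝ} {η : ℝ} {n : ℕ∞} (ha : ContDiff ℝ n a) (hb : ContDiff ℝ n b) :
    ContDiff ℝ n fun z => smoothMax η (a z) (b z) :=
  (contDiff_smoothMax (η := η) (n := n)).comp (ha.prodMk hb)

end Literature.Geometry.Symplectic

end
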